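import Literature.ModelTheory.FiniteModelTheory.ESOInputBits
import Literature.Computability.Complexity.FaginClauses
import HarnessLib

/-!
# The tableau layer of Fagin's theorem (hard direction `NP ⊆ ∃SO`): preliminaries

Topic `Literature/ModelTheory/FiniteModelTheory`; continues `ESOInputBits.lean` towards the
discharge of the named fact `NP_subset_eso` of `Fagin.lean` (Libkin 2004, proof of Thm. 9.6,
second part, pp. 170–173; Immerman 1999, Thm. 7.8), completed in `FaginTableau.lean`. The
machine side is the tree's MACHINE-FREE form of `NP` membership, `FaginClauses.lean`:
`x ∈ L ↔ ∃ τ, Tableau.ClausesHold M x (p |x|) (faginT p q |x|) τ` — solvability of the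
Cook–Levin clause families of a `FinTM2` verifier `M` (Sipser 2012, Thm. 7.37), an assignment
`τ` of the block variables "block `J` of row `t` holds value `v ∈ Val M.tm`". Libkin's sentence
(9.1) `∃ L ∃ T₀ T₁ T₂ ∃ (H_q)_q Ψ` guesses exactly such an assignment as second-order relations
indexed by tuples. This file provides the pieces between the two:

* `ClausesHoldS` — the clause families in `σ`-FORM (`σ t J v` a predicate on numbers instead of
  `τ (blk t J, v)`; `clausesHold_iff_clausesHoldS` is `Iff.rfl`) and `clausesHoldS_congr`: they
  only read rows `≤ T` and blocks `≤ S₁`;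
* the TABLEAU LAYOUT `tabWit M K` (one witness symbol of arity `K + K` per block value), its
  atom `CellP`, the `σ` read off witness tables (`SigmaW`), the tables of an assignment
  (`relsOf`, `sigmaW_relsOf`) and the assignment of a `σ` (`assignOf`, `assignOf_blk`);
* INDEX TERMS over the guessed arithmetic of `ESOArith.lean`/`ESOInputBits.lean`: sums of a
  numeral and variable tuples (`IsSumN`, `isSumN_iff`), guards (`LtE`, `LeE`), and the atom at
  index terms (`AtN`, `atN_iff`), each with its DEFINABILITY (`JQuery.isDef_isSumN`, `isDef_atN`, …);
* NUMERALS for the parameters: polynomials of numerals (`NExpr.ofPoly`, `eval_ofPoly`), the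
  numerals `PE, NNE, TE, dTE, NNdTE, S1E` of `P = p(m)`, `NN = 2m + 2 + P`, `T = q(NN)`, `d T`,
  `S₁` (`m` the code length, `eval_TE : … = faginT p q m`), the master bound `boundE` and
  `bounds_of_boundE`; and **every numeral is eventually below a fixed power of `n`**
  (`NExpr.exists_req_lt`, by induction on the numeral), whence the choice of the tuple width
  `K` (`exists_width`: Libkin's "`k` such that the machine runs in time `n^k`", p. 170).

## References

* L. Libkin, *Elements of Finite Model Theory*, Springer 2004, proof of Thm. 9.6, pp. 170–173
  (printed pages; PDF = printed + 18 in the held copy `book:libkinnd-elements-finite-model-theory`).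
* N. Immerman, *Descriptive Complexity*, Springer 1999, Thm. 7.8.
* M. Sipser, *Introduction to the Theory of Computation*, 3rd ed., 2012, Thm. 7.37.
* R. Fagin, *Generalized first-order spectra and polynomial-time recognizable sets*, SIAM–AMS
  Proc. 7 (1974), 43–73.
-/

namespace Literature.ModelTheory.FiniteModelTheory

open _root_.Computability Literature.Computability.Complexity
  Literature.Computability.Complexity.Tableau Literature.Computability.Cryptography

/-! ### The Cook–Levin clause families in `σ`-form -/

section SigmaForm

variable (M : Turing.TM2ComputableAux Bool Bool)

attribute [local instance] Turing.FinTM2.kFin Turing.FinTM2.ΛFin Turing.FinTM2.σFin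
  Turing.FinTM2.Γk₀Fin

section Defs

variable (x : List Bool)

local notation "m" => x.length
local notation "d" => dM M

/-- **The Cook–Levin clause families in `σ`-form**: `Tableau.ClausesHold M x P T τ`
(`FaginClauses.lean`) with the assignment presented as a predicate `σ t J v` — "block `J` of
row `t` holds value `v`" — instead of `τ (blk t J, v) = true`. This is the shape an `∃SO`
sentence expresses: rows and columns are numbers `≤ T`, `≤ S₁`, values range over the finite
type `Val M.tm`. This is a PREDICATE in `M x P T σ` (a definition, not a closed statement: `M`
and `x` are section variables, `P`, `T`, `σ` explicit binders). [Sipser 2012, Thm. 7.37 (proof);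
Libkin 2004, proof of Thm. 9.6, p. 171 (the predicates `T₀, T₁, T₂, H_q`)] [folklore] -/
def ClausesHoldS (P T : ℕ) (σ : ℕ → ℕ → Val M.tm → Prop) : Prop :=
  (∀ (i : ℕ) (b : Bool), x[i]? = some b →
      σ 0 (2 * i + 1) (symVal M b) ∧ σ 0 (2 * i + 2) (symVal M b)) ∧
  (σ 0 0 (ctrlVal M) ∧ σ 0 (2 * m + 1) (symVal M false) ∧ σ 0 (2 * m + 2) (symVal M true)) ∧
  (∀ j : ℕ, j < P →
      (σ 0 (2 * m + 3 + j) (symVal M false) ∨ σ 0 (2 * m + 3 + j) (symVal M true) ∨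
        σ 0 (2 * m + 3 + j) (noneVal M.tm)) ∧
      (σ 0 (2 * m + 3 + j) (noneVal M.tm) → σ 0 (2 * m + 4 + j) (noneVal M.tm))) ∧
  (∀ j : ℕ, j < d * T + 3 * d → σ 0 (NN m P + 1 + j) (noneVal M.tm)) ∧
  (∀ t : ℕ, t < T → ∀ (a : Fin (3 * d + 1) → Val M.tm) (r : Fin (2 * d + 1)),
      (∀ s : Fin (3 * d + 1), σ t s (a s)) → σ (t + 1) r (topF d a r)) ∧
  (∀ t : ℕ, t < T → ∀ j : ℕ, j < NN m P + d * T →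
      ∀ (h : Fin (d + 1) → Val M.tm) (nb : Fin (2 * d + 1) → Val M.tm),
        (∀ s : Fin (d + 1), σ t s (h s)) →
        (∀ s : Fin (2 * d + 1), σ t (d + 1 + j + s) (nb s)) →
          σ (t + 1) (2 * d + 1 + j) (intF d h nb)) ∧
  (∀ t : ℕ, t < T → ∀ r : ℕ, r < d →
      σ (t + 1) (NN m P + d * T + 2 * d + 1 + r) (noneVal M.tm)) ∧
  (∀ t : ℕ, t ≤ T → ∀ J : ℕ, J ≤ S1 M m P T →
      (∃ v, σ t J v) ∧ ∀ v v', v ≠ v' → ¬ (σ t J v ∧ σ t J v')) ∧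
  σ T 1 (accVal M)

end Defs

variable {M}

/-- `ClausesHold` IS the `σ`-form at `σ t J v := τ (blk t J, v)` (definitional). [folklore] -/
theorem clausesHold_iff_clausesHoldS (x : List Bool) (P T : ℕ) (τ : TVar M → Bool) :
    ClausesHold M x P T τ ↔
      ClausesHoldS M x P T (fun t J v => τ (blk M x.length P T t J, v) = true) :=
  Iff.rfl

/-- The window parameter is positive. [folklore] -/
theorem one_le_dM : 1 ≤ dM M := Nat.succ_pos _

/-- `S₁` unfolded. [folklore] -/
theorem S1_eq (n P T : ℕ) : S1 M n P T = 2 * n + 2 + P + dM M * T + 3 * dM M := rfl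

/-- **The `σ`-form only looks at rows `≤ T` and blocks `≤ S₁`.** [folklore] -/
theorem clausesHoldS_congr (x : List Bool) (P T : ℕ) {σ σ' : ℕ → ℕ → Val M.tm → Prop}
    (h : ∀ t, t ≤ T → ∀ J, J ≤ S1 M x.length P T → ∀ v, (σ t J v ↔ σ' t J v)) :
    ClausesHoldS M x P T σ ↔ ClausesHoldS M x P T σ' := by
  unfold ClausesHoldS
  simp only [NN, S1_eq] at h ⊢
  have hd : 1 ≤ dM M := one_le_dM
  have hDT : T ≤ dM M * T := Nat.le_mul_of_pos_left T hd
  generalize dM M * T = D at h hDT ⊢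
  generalize dM M = d at hd h ⊢
  refine and_congr ?_ (and_congr ?_ (and_congr ?_ (and_congr ?_ (and_congr ?_ (and_congr ?_
    (and_congr ?_ (and_congr ?_ ?_)))))))
  · refine forall_congr' fun i => forall_congr' fun b => imp_congr_right fun hb => ?_
    obtain ⟨hi, -⟩ := List.getElem?_eq_some_iff.1 hb
    exact and_congr (h 0 (Nat.zero_le _) _ (by omega) _) (h 0 (Nat.zero_le _) _ (by omega) _)
  · exact and_congr (h 0 (Nat.zero_le _) _ (by omega) _)
      (and_congr (h 0 (Nat.zero_le _) _ (by omega) _) (h 0 (Nat.zero_le _) _ (by omega) _))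
  · refine forall_congr' fun j => imp_congr_right fun hj => ?_
    have h3 := h 0 (Nat.zero_le _) (2 * x.length + 3 + j) (by omega)
    have h4 := h 0 (Nat.zero_le _) (2 * x.length + 4 + j) (by omega)
    exact and_congr (or_congr (h3 _) (or_congr (h3 _) (h3 _))) (imp_congr (h3 _) (h4 _))
  · exact forall_congr' fun j => imp_congr_right fun hj => h 0 (Nat.zero_le _) _ (by omega) _
  · refine forall_congr' fun t => imp_congr_right fun ht => forall_congr' fun a =>
      forall_congr' fun r => imp_congr (forall_congr' fun s => ?_) ?_
    · exact h t ht.le _ (by have := s.2; omega) _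
    · exact h (t + 1) ht _ (by have := r.2; omega) _
  · refine forall_congr' fun t => imp_congr_right fun ht => forall_congr' fun j =>
      imp_congr_right fun hj => forall_congr' fun hh => forall_congr' fun nb =>
        imp_congr (forall_congr' fun s => ?_) (imp_congr (forall_congr' fun s => ?_) ?_)
    · exact h t ht.le _ (by have := s.2; omega) _
    · exact h t ht.le _ (by have := s.2; omega) _
    · exact h (t + 1) ht _ (by omega) _
  · exact forall_congr' fun t => imp_congr_right fun ht => forall_congr' fun r =>
      imp_congr_right fun hr => h (t + 1) ht _ (by omega) _
  · refine forall_congr' fun t => imp_congr_right fun ht => forall_congr' fun J =>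
      imp_congr_right fun hJ => and_congr (exists_congr fun v => h t ht J hJ v)
        (forall_congr' fun v => forall_congr' fun v' => imp_congr_right fun _ =>
          not_congr (and_congr (h t ht J hJ v) (h t ht J hJ v')))
  · exact h T le_rfl 1 (by omega) _

end SigmaForm

/-! ### The tableau witness layout: one relation of arity `K + K` per block value -/

section Layout

variable (M : Turing.TM2ComputableAux Bool Bool) (K : ℕ)

attribute [local instance] Turing.FinTM2.kFin Turing.FinTM2.ΛFin Turing.FinTM2.σFin
  Turing.FinTM2.Γk₀Fin

/-- The number of block values `|Val M.tm|`. [folklore] -/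
noncomputable def nVal : ℕ := Nat.card (Val M.tm)

/-- An enumeration of the block values. [folklore] -/
noncomputable def valEquiv : Val M.tm ≃ Fin (nVal M) := Finite.equivFin (Val M.tm)

/-- **The tableau layout**: one witness relation symbol of arity `K + K` for each block value
`v` — "block `J̄` of row `t̄` holds `v`", rows and blocks being `K`-tuples (Libkin's tape
predicates `T₀, T₁, T₂` and head/state predicates `H_q` of arity `2k`, merged into one symbol per
value of a whole block). [Libkin 2004, proof of Thm. 9.6, p. 171] [folklore] -/
noncomputable def tabWit : List ℕ := List.replicate (nVal M) (K + K)

/-- The layout has `|Val|` symbols. [folklore] -/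
theorem length_tabWit : (tabWit M K).length = nVal M := List.length_replicate ..

/-- Every symbol of the layout has arity `K + K`. [folklore] -/
theorem get_tabWit (i : Fin (tabWit M K).length) : (tabWit M K).get i = K + K := by
  simp [tabWit]

/-- The symbol of a block value. [folklore] -/
noncomputable def valIdx (v : Val M.tm) : Fin (tabWit M K).length :=
  (valEquiv M v).cast (length_tabWit M K).symm

/-- The block value of a symbol. [folklore] -/
noncomputable def idxVal (i : Fin (tabWit M K).length) : Val M.tm :=
  (valEquiv M).symm (i.cast (length_tabWit M K))

/-- `idxVal ∘ valIdx = id`. [folklore] -/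
@[simp] theorem idxVal_valIdx (v : Val M.tm) : idxVal M K (valIdx M K v) = v := by
  simp [idxVal, valIdx]

/-- `valIdx ∘ idxVal = id`. [folklore] -/
@[simp] theorem valIdx_idxVal (i : Fin (tabWit M K).length) : valIdx M K (idxVal M K i) = i := by
  simp [idxVal, valIdx]

variable {M K} {n : ℕ}

/-- **The tableau atom**: in the witness tables `Wr`, block `J̄` of row `t̄` holds value `v`.
[Libkin 2004, p. 171] [folklore] -/
noncomputable def CellP (Wr : RelTables (tabWit M K) n) (v : Val M.tm) (t J : Fin K → Fin n) : Prop :=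
  Wr (valIdx M K v) (Fin.append t J ∘ Fin.cast (get_tabWit M K _)) = true

/-- The `σ` READ OFF witness tables: `σ t J v` iff `t, J < n^K` and the atom holds at their
tuples. [folklore] -/
def SigmaW (Wr : RelTables (tabWit M K) n) (t J : ℕ) (v : Val M.tm) : Prop :=
  ∃ (ht : t < n ^ K) (hJ : J < n ^ K), CellP Wr v (tupOf t ht) (tupOf J hJ)

/-- The witness tables OF AN ASSIGNMENT `τ` of the block variables (blocks numbered by
`β t J`): value `v` at `(t̄, J̄)` iff `τ (β t J, v)`. [Libkin 2004, p. 171] [folklore] -/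
noncomputable def relsOf (β : ℕ → ℕ → ℕ) (τ : TVar M → Bool) : RelTables (tabWit M K) n :=
  fun i w => τ (β (tval (fst2 (w ∘ Fin.cast (get_tabWit M K i).symm)))
    (tval (snd2 (w ∘ Fin.cast (get_tabWit M K i).symm))), idxVal M K i)

/-- The atom on the tables of `τ`. [folklore] -/
theorem cellP_relsOf (β : ℕ → ℕ → ℕ) (τ : TVar M → Bool) (v : Val M.tm) (t J : Fin K → Fin n) :
    CellP (relsOf β τ) v t J ↔ τ (β (tval t) (tval J), v) = true := by
  unfold CellP relsOf
  have : (Fin.append t J ∘ Fin.cast (get_tabWit M K (valIdx M K v))) ∘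
      Fin.cast (get_tabWit M K (valIdx M K v)).symm = Fin.append t J := by
    funext i; simp
  rw [this, fst2_append, snd2_append, idxVal_valIdx]

/-- The `σ` read off the tables of `τ` is `τ` (on numbers `< n^K`). [folklore] -/
theorem sigmaW_relsOf (β : ℕ → ℕ → ℕ) (τ : TVar M → Bool) (t J : ℕ) (v : Val M.tm) :
    SigmaW (K := K) (n := n) (relsOf β τ) t J v ↔ t < n ^ K ∧ J < n ^ K ∧ τ (β t J, v) = true := by
  unfold SigmaW
  simp only [cellP_relsOf, tval_tupOf]
  exact ⟨fun ⟨ht, hJ, h⟩ => ⟨ht, hJ, h⟩, fun ⟨ht, hJ, h⟩ => ⟨ht, hJ, h⟩⟩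

/-- Conversely, THE ASSIGNMENT OF A `σ`: block `b` (row `b / RB`, column `b % RB`) holds `v`
iff `σ (b / RB) (b % RB) v`. [folklore] -/
noncomputable def assignOf (RB : ℕ) (σ : ℕ → ℕ → Val M.tm → Prop) : TVar M → Bool :=
  fun bv => by classical exact decide (σ (bv.1 / RB) (bv.1 % RB) bv.2)

/-- The assignment of `σ` at block `blk t J = t · RB + J`, `J < RB`. [folklore] -/
theorem assignOf_blk (m P T : ℕ) (σ : ℕ → ℕ → Val M.tm → Prop) {t J : ℕ} (hJ : J < RB M m P T)
    (v : Val M.tm) : assignOf (RB M m P T) σ (blk M m P T t J, v) = true ↔ σ t J v := by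
  unfold assignOf blk
  have hRB : 0 < RB M m P T := by omega
  simp only [decide_eq_true_eq]
  rw [Nat.mul_comm t, Nat.mul_add_div hRB, Nat.mul_add_mod, Nat.div_eq_of_lt hJ, Nat.add_zero,
    Nat.mod_eq_of_lt hJ]

end Layout

/-! ### Definability of the tableau atom -/

namespace JQuery

variable {M : Turing.TM2ComputableAux Bool Bool} {ar : List ℕ} {K : ℕ} {α : Type}

attribute [local instance] Turing.FinTM2.kFin Turing.FinTM2.ΛFin Turing.FinTM2.σFin
  Turing.FinTM2.Γk₀Fin

/-- The tableau atom on variable tuples is definable (a witness atom of the layout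
`arithWit K (tabWit M K)`). [folklore] -/
theorem isDef_cellP (val : Val M.tm) (a b : Fin K → α) :
    IsDef (fun _ (_ : RelTables ar _) (W : RelTables (arithWit K (tabWit M K)) _) (v : α → _) =>
      CellP (restT W) val (v ∘ a) (v ∘ b)) :=
  (isDef_witRel (ar := ar) (wit := tabWit M K) (valIdx M K val)
    (Fin.append a b ∘ Fin.cast (get_tabWit M K _))).onRest.of_iff fun _ _ W v => by
      rw [CellP, ← Function.comp_assoc, map_finAppend]

end JQuery

/-! ### Sums of a numeral and variable tuples; guards; the atom at index terms -/

section Sums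

variable {K : ℕ} {rest : List ℕ} {n : ℕ}

/-- The sum of the numbers of a list of tuples. [folklore] -/
def lsum (us : List (Fin K → Fin n)) : ℕ := (us.map tval).sum

/-- `lsum [] = 0`. [folklore] -/
@[simp] theorem lsum_nil : lsum ([] : List (Fin K → Fin n)) = 0 := rfl

/-- `lsum (u :: us) = tval u + lsum us`. [folklore] -/
@[simp] theorem lsum_cons (u : Fin K → Fin n) (us : List (Fin K → Fin n)) :
    lsum (u :: us) = tval u + lsum us := by
  simp [lsum]

/-- `IsSumN W e us w`: the tuple `w` codes `e.eval n + Σ_{u ∈ us} tval u` (a numeral plus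
variable tuples, by iterated `PLUS`). [Libkin 2004, p. 172] [folklore] -/
def IsSumN (W : RelTables (arithWit K rest) n) (e : NExpr) :
    List (Fin K → Fin n) → (Fin K → Fin n) → Prop
  | [], w => IsVal W e w
  | u :: us, w => ∃ w', IsSumN W e us w' ∧ PlusP W w' u w

/-- The guard `tval u < e`. [folklore] -/
def LtE (W : RelTables (arithWit K rest) n) (u : Fin K → Fin n) (e : NExpr) : Prop :=
  ∃ w, IsVal W e w ∧ LtN W u w

/-- The guard `tval u ≤ e`. [folklore] -/
def LeE (W : RelTables (arithWit K rest) n) (u : Fin K → Fin n) (e : NExpr) : Prop :=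
  ∃ w, IsVal W e w ∧ LeN W u w

variable {W : RelTables (arithWit K rest) n}

/-- **Correctness of sums** over standard arithmetic (for a bounded numeral):
`IsSumN e us w ↔ tval w = e.eval n + lsum us`. [folklore] -/
theorem isSumN_iff (hW : IsStdArith W) (hK : 1 ≤ K) {e : NExpr} (he : e.Bdd n K) :
    ∀ (us : List (Fin K → Fin n)) (w : Fin K → Fin n),
      IsSumN W e us w ↔ tval w = e.eval n + lsum us
  | [], w => by rw [IsSumN, isVal_iff hW hK he, lsum_nil, Nat.add_zero]
  | u :: us, w => by
    unfold IsSumN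
    simp only [isSumN_iff hW hK he us, hW.2.1, lsum_cons]
    constructor
    · rintro ⟨w', h', hp⟩; omega
    · intro h
      have hlt : e.eval n + lsum us < n ^ K := by have := tval_lt w; omega
      exact ⟨tupOf _ hlt, tval_tupOf _ _, by rw [tval_tupOf]; omega⟩

/-- Correctness of the guard `<`. [folklore] -/
theorem ltE_iff (hW : IsStdArith W) (hK : 1 ≤ K) {e : NExpr} (he : e.Bdd n K)
    (u : Fin K → Fin n) : LtE W u e ↔ tval u < e.eval n := by
  unfold LtE
  simp only [isVal_iff hW hK he, ltN_iff hW]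
  exact ⟨fun ⟨w, hw, h⟩ => hw ▸ h, fun h =>
    ⟨tupOf _ (NExpr.eval_lt_of_bdd he), tval_tupOf _ _, by rwa [tval_tupOf]⟩⟩

/-- Correctness of the guard `≤`. [folklore] -/
theorem leE_iff (hW : IsStdArith W) (hK : 1 ≤ K) {e : NExpr} (he : e.Bdd n K)
    (u : Fin K → Fin n) : LeE W u e ↔ tval u ≤ e.eval n := by
  unfold LeE
  simp only [isVal_iff hW hK he, leN_iff hW]
  exact ⟨fun ⟨w, hw, h⟩ => hw ▸ h, fun h =>
    ⟨tupOf _ (NExpr.eval_lt_of_bdd he), tval_tupOf _ _, by rwa [tval_tupOf]⟩⟩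

end Sums

section AtN

variable {M : Turing.TM2ComputableAux Bool Bool} {K : ℕ} {n : ℕ}

attribute [local instance] Turing.FinTM2.kFin Turing.FinTM2.ΛFin Turing.FinTM2.σFin
  Turing.FinTM2.Γk₀Fin

/-- **The tableau atom at index terms**: whenever `t̄` codes `e₁ + Σ us₁` and `J̄` codes
`e₂ + Σ us₂`, block `J̄` of row `t̄` holds `v`. [Libkin 2004, p. 171] [folklore] -/
def AtN (W : RelTables (arithWit K (tabWit M K)) n) (v : Val M.tm) (e₁ : NExpr)
    (us₁ : List (Fin K → Fin n)) (e₂ : NExpr) (us₂ : List (Fin K → Fin n)) : Prop :=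
  ∀ t J : Fin K → Fin n, IsSumN W e₁ us₁ t → IsSumN W e₂ us₂ J → CellP (restT W) v t J

variable {W : RelTables (arithWit K (tabWit M K)) n}

/-- **Correctness of the atom at index terms** (both index values `< n^K`): it is the `σ` read
off the tables at those values. [folklore] -/
theorem atN_iff (hW : IsStdArith W) (hK : 1 ≤ K) {v : Val M.tm} {e₁ e₂ : NExpr}
    (he₁ : e₁.Bdd n K) (he₂ : e₂.Bdd n K) {us₁ us₂ : List (Fin K → Fin n)}
    (h₁ : e₁.eval n + lsum us₁ < n ^ K) (h₂ : e₂.eval n + lsum us₂ < n ^ K) :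
    AtN W v e₁ us₁ e₂ us₂ ↔ SigmaW (restT W) (e₁.eval n + lsum us₁) (e₂.eval n + lsum us₂) v := by
  unfold AtN SigmaW
  simp only [isSumN_iff hW hK he₁, isSumN_iff hW hK he₂]
  constructor
  · intro h
    exact ⟨h₁, h₂, h _ _ (tval_tupOf _ _) (tval_tupOf _ _)⟩
  · rintro ⟨h₁', h₂', h⟩ t J ht hJ
    have et : t = tupOf _ h₁' := tval_injective (by rw [ht, tval_tupOf])
    have eJ : J = tupOf _ h₂' := tval_injective (by rw [hJ, tval_tupOf])
    rw [et, eJ]; exact h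

end AtN

/-! ### Definability of sums, guards and the atom at index terms -/

namespace JQuery

variable {M : Turing.TM2ComputableAux Bool Bool} {ar rest : List ℕ} {K : ℕ}

attribute [local instance] Turing.FinTM2.kFin Turing.FinTM2.ΛFin Turing.FinTM2.σFin
  Turing.FinTM2.Γk₀Fin

/-- Sums on variable tuples are definable (induction on the list). [folklore] -/
theorem isDef_isSumN (e : NExpr) : ∀ {α : Type} (us : List (Fin K → α)) (w : Fin K → α),
    IsDef (fun _ (_ : RelTables ar _) (W : RelTables (arithWit K rest) _) (v : α → _) =>
      IsSumN W e (us.map (v ∘ ·)) (v ∘ w))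
  | _, [], w => (isDef_isVal e w).of_iff fun _ _ _ _ => Iff.rfl
  | α, u :: us, w => by
    have h1 := isDef_isSumN e (α := α ⊕ Fin K) (us.map (Sum.inl ∘ ·)) Sum.inr
    have h2 := isDef_plusP (ar := ar) (K := K) (rest := rest) (α := α ⊕ Fin K) Sum.inr
      (Sum.inl ∘ u) (Sum.inl ∘ w)
    refine ((h1.and h2).exs).of_iff fun _ _ W v => ?_
    simp only [List.map_cons, List.map_map, IsSumN]
    exact Iff.rfl
termination_by _ us _ => us.length

/-- The guard `<` is definable. [folklore] -/
theorem isDef_ltE {α : Type} (a : Fin K → α) (e : NExpr) :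
    IsDef (fun _ (_ : RelTables ar _) (W : RelTables (arithWit K rest) _) (v : α → _) =>
      LtE W (v ∘ a) e) :=
  (((isDef_isVal (ar := ar) (K := K) (rest := rest) e (α := α ⊕ Fin K) Sum.inr).and
    (isDef_ltN (Sum.inl ∘ a) Sum.inr)).exs).of_iff fun _ _ _ _ => Iff.rfl

/-- The guard `≤` is definable. [folklore] -/
theorem isDef_leE {α : Type} (a : Fin K → α) (e : NExpr) :
    IsDef (fun _ (_ : RelTables ar _) (W : RelTables (arithWit K rest) _) (v : α → _) =>
      LeE W (v ∘ a) e) :=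
  (((isDef_isVal (ar := ar) (K := K) (rest := rest) e (α := α ⊕ Fin K) Sum.inr).and
    (isDef_leN (Sum.inl ∘ a) Sum.inr)).exs).of_iff fun _ _ _ _ => Iff.rfl

/-- **The atom at index terms is definable.** [Libkin 2004, p. 171] [folklore] -/
theorem isDef_atN {α : Type} (val : Val M.tm) (e₁ : NExpr) (us₁ : List (Fin K → α)) (e₂ : NExpr)
    (us₂ : List (Fin K → α)) :
    IsDef (fun _ (_ : RelTables ar _) (W : RelTables (arithWit K (tabWit M K)) _) (v : α → _) =>
      AtN W val e₁ (us₁.map (v ∘ ·)) e₂ (us₂.map (v ∘ ·))) := by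
  let V : Type := (α ⊕ Fin K) ⊕ Fin K
  let tV : Fin K → V := fun i => Sum.inl (Sum.inr i)
  let JV : Fin K → V := fun i => Sum.inr i
  have h := ((isDef_isSumN (ar := ar) (rest := tabWit M K) e₁
    (us₁.map ((Sum.inl ∘ Sum.inl : α → V) ∘ ·)) tV).imp
    ((isDef_isSumN e₂ (us₂.map ((Sum.inl ∘ Sum.inl : α → V) ∘ ·)) JV).imp
      (isDef_cellP val tV JV))).alls.alls
  refine h.of_iff fun _ _ W v => ?_
  simp only [List.map_map, AtN]
  exact Iff.rfl

end JQuery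

/-! ### Polynomials as numerals; every numeral is eventually bounded by a power of `n` -/

namespace NExpr

/-- Powers `e^i` of a numeral. [folklore] -/
def epow (e : NExpr) : ℕ → NExpr
  | 0 => const 1
  | i + 1 => mul (epow e i) e

/-- `(epow e i).eval n = (e.eval n)^i`. [folklore] -/
@[simp] theorem eval_epow (e : NExpr) (n : ℕ) : ∀ i : ℕ, (epow e i).eval n = e.eval n ^ i
  | 0 => rfl
  | i + 1 => by rw [epow, eval, eval_epow e n i, pow_succ]

/-- `Σ_{i<k} cᵢ · e^i`. [folklore] -/
def sumPow (e : NExpr) (c : ℕ → ℕ) : ℕ → NExpr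
  | 0 => const 0
  | k + 1 => add (sumPow e c k) (mul (const (c k)) (epow e k))

/-- `(sumPow e c k).eval n = Σ_{i<k} cᵢ (e.eval n)^i`. [folklore] -/
theorem eval_sumPow (e : NExpr) (c : ℕ → ℕ) (n : ℕ) :
    ∀ k : ℕ, (sumPow e c k).eval n = ∑ i ∈ Finset.range k, c i * e.eval n ^ i
  | 0 => by simp [sumPow, eval]
  | k + 1 => by rw [sumPow, eval, eval_sumPow e c n k, Finset.sum_range_succ, eval, eval, eval_epow]

/-- **A polynomial of a numeral** `p(e)`, `p : ℕ[X]`. [Libkin 2004, p. 170 (time `n^k`)]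
[folklore] -/
noncomputable def ofPoly (p : Polynomial ℕ) (e : NExpr) : NExpr := sumPow e p.coeff (p.natDegree + 1)

/-- `(ofPoly p e).eval n = p.eval (e.eval n)`. [folklore] -/
@[simp] theorem eval_ofPoly (p : Polynomial ℕ) (e : NExpr) (n : ℕ) :
    (ofPoly p e).eval n = p.eval (e.eval n) := by
  rw [ofPoly, eval_sumPow, Polynomial.eval_eq_sum_range]

/-- `Bdd` gives the bound on `req` (converse of `bdd_of_req_lt`). [folklore] -/
theorem req_lt_of_bdd {n K : ℕ} : ∀ {e : NExpr}, e.Bdd n K → e.req n < n ^ K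
  | const _, h => h
  | univ, h => h
  | size, h => h
  | add _ _, h => by
    simp only [req, max_lt_iff]
    exact ⟨⟨req_lt_of_bdd h.1, req_lt_of_bdd h.2.1⟩, h.2.2⟩
  | mul _ _, h => by
    simp only [req, max_lt_iff]
    exact ⟨⟨req_lt_of_bdd h.1, req_lt_of_bdd h.2.1⟩, h.2.2⟩

/-- `Bdd n K ↔ req n < n^K`. [folklore] -/
theorem bdd_iff_req_lt {n K : ℕ} (e : NExpr) : e.Bdd n K ↔ e.req n < n ^ K :=
  ⟨req_lt_of_bdd, bdd_of_req_lt⟩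

/-- `2^{|bin n|} ≤ 2n` for `n ≥ 1`. [folklore] -/
theorem two_pow_size_le {n : ℕ} (hn : 1 ≤ n) : 2 ^ Nat.size n ≤ 2 * n := by
  rcases two_pow_size_pred_le n with h | h
  · rw [h, pow_zero]; omega
  · have : 2 ^ Nat.size n = 2 * 2 ^ (Nat.size n - 1) := by
      rw [← pow_succ']; congr 1; have := Nat.size_pos.2 (by omega : 0 < n); omega
    rw [this]; omega

/-- **Every numeral is eventually below a fixed power of `n`**: `req e n < n^D` for all `n ≥ 2`.
[folklore] -/
theorem exists_req_lt (e : NExpr) : ∃ D : ℕ, ∀ n : ℕ, 2 ≤ n → e.req n < n ^ D := by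
  induction e with
  | const c => exact ⟨c, fun n hn => Nat.lt_two_pow_self.trans_le (Nat.pow_le_pow_left hn c)⟩
  | univ => exact ⟨2, fun n hn => by
      calc n = n ^ 1 := (pow_one n).symm
        _ < n ^ 2 := Nat.pow_lt_pow_right (by omega) (by norm_num)⟩
  | size => exact ⟨3, fun n hn => by
      have h1 := two_pow_size_le (n := n) (by omega)
      have h2 : 2 ^ 2 ≤ n ^ 2 := Nat.pow_le_pow_left hn 2
      have h3 : n ^ 2 * n = n ^ 3 := (pow_succ n 2).symm
      have h4 : 4 * n ≤ n ^ 2 * n := Nat.mul_le_mul_right n h2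
      show 2 ^ Nat.size n < n ^ 3
      omega⟩
  | add e₁ e₂ ih₁ ih₂ =>
    obtain ⟨D₁, h₁⟩ := ih₁
    obtain ⟨D₂, h₂⟩ := ih₂
    refine ⟨D₁ + D₂ + 1, fun n hn => ?_⟩
    have hA₁ : n ^ D₁ ≤ n ^ (D₁ + D₂) := Nat.pow_le_pow_right (by omega) (by omega)
    have hA₂ : n ^ D₂ ≤ n ^ (D₁ + D₂) := Nat.pow_le_pow_right (by omega) (by omega)
    have hB : n ^ (D₁ + D₂) * 2 ≤ n ^ (D₁ + D₂ + 1) := by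
      rw [pow_succ]; exact Nat.mul_le_mul_left _ hn
    have hv₁ := eval_le_req n e₁
    have hv₂ := eval_le_req n e₂
    have hr₁ := h₁ n hn
    have hr₂ := h₂ n hn
    simp only [req, max_lt_iff]
    omega
  | mul e₁ e₂ ih₁ ih₂ =>
    obtain ⟨D₁, h₁⟩ := ih₁
    obtain ⟨D₂, h₂⟩ := ih₂
    refine ⟨D₁ + D₂ + 1, fun n hn => ?_⟩
    have hA₁ : n ^ D₁ ≤ n ^ (D₁ + D₂) := Nat.pow_le_pow_right (by omega) (by omega)
    have hA₂ : n ^ D₂ ≤ n ^ (D₁ + D₂) := Nat.pow_le_pow_right (by omega) (by omega)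
    have hB : n ^ (D₁ + D₂) ≤ n ^ (D₁ + D₂ + 1) := Nat.pow_le_pow_right (by omega) (by omega)
    have hv₁ := eval_le_req n e₁
    have hv₂ := eval_le_req n e₂
    have hr₁ := h₁ n hn
    have hr₂ := h₂ n hn
    have hm : e₁.eval n * e₂.eval n < n ^ (D₁ + D₂) := by
      rw [pow_add]; exact Nat.mul_lt_mul'' (hv₁.trans_lt hr₁) (hv₂.trans_lt hr₂)
    simp only [req, max_lt_iff]
    omega

/-- Hence `e` is bounded at every `n ≥ 2` for every `K ≥ D`. [folklore] -/
theorem exists_forall_bdd (e : NExpr) : ∃ D : ℕ, ∀ n : ℕ, 2 ≤ n → ∀ K : ℕ, D ≤ K → e.Bdd n K := by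
  obtain ⟨D, hD⟩ := exists_req_lt e
  exact ⟨D, fun n hn K hK => bdd_of_req_lt ((hD n hn).trans_le (Nat.pow_le_pow_right (by omega) hK))⟩

end NExpr

/-! ### The numerals of the tableau: `m = |code|`, `P = p(m)`, `NN = 2m + 2 + P`, `T = q(NN)`,
`d·T`, `S₁`, and one master bound -/

section Params

variable (ar : List ℕ) (d : ℕ) (p q : Polynomial ℕ)

/-- `P = p(m)`, the certificate bound. [Sipser 2012, Thm. 7.37] [folklore] -/
noncomputable def PE : NExpr := NExpr.ofPoly p (NExpr.codeLenE ar)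

/-- `2m`. [folklore] -/
def twoME : NExpr := NExpr.mul (NExpr.const 2) (NExpr.codeLenE ar)

/-- `NN = 2m + 2 + P`, the verifier input length. [folklore] -/
noncomputable def NNE : NExpr := NExpr.add (NExpr.add (twoME ar) (NExpr.const 2)) (PE ar p)

/-- `T = q(NN)`, the time bound `faginT p q m`. [folklore] -/
noncomputable def TE : NExpr := NExpr.ofPoly q (NNE ar p)

/-- `d · T`. [folklore] -/
noncomputable def dTE : NExpr := NExpr.mul (NExpr.const d) (TE ar p q)

/-- `NN + d · T`. [folklore] -/
noncomputable def NNdTE : NExpr := NExpr.add (NNE ar p) (dTE ar d p q)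

/-- `S₁ = NN + d · T + 3 d`, the last block of a row. [folklore] -/
noncomputable def S1E : NExpr := NExpr.add (NNdTE ar d p q) (NExpr.const (3 * d))

/-- The MASTER BOUND `S₁ + T + 8`: if it is a bounded numeral then so is every numeral of the
tableau sentence, and all rows, blocks and positions are tuple numbers. [folklore] -/
noncomputable def boundE : NExpr := NExpr.add (NExpr.add (S1E ar d p q) (TE ar p q)) (NExpr.const 8)

variable {ar d p q} {n m : ℕ}

/-- Value of `PE`. [folklore] -/
theorem eval_PE (hm : (NExpr.codeLenE ar).eval n = m) : (PE ar p).eval n = p.eval m := by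
  rw [PE, NExpr.eval_ofPoly, hm]

/-- Value of `twoME`. [folklore] -/
theorem eval_twoME (hm : (NExpr.codeLenE ar).eval n = m) : (twoME ar).eval n = 2 * m := by
  simp [twoME, NExpr.eval, hm]

/-- Value of `NNE`. [folklore] -/
theorem eval_NNE (hm : (NExpr.codeLenE ar).eval n = m) : (NNE ar p).eval n = NN m (p.eval m) := by
  simp [NNE, NN, NExpr.eval, eval_twoME hm, eval_PE hm]

/-- Value of `TE`: the time bound `faginT p q m`. [folklore] -/
theorem eval_TE (hm : (NExpr.codeLenE ar).eval n = m) : (TE ar p q).eval n = faginT p q m := by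
  rw [TE, NExpr.eval_ofPoly, eval_NNE hm]; rfl

/-- Value of `dTE`. [folklore] -/
theorem eval_dTE (hm : (NExpr.codeLenE ar).eval n = m) : (dTE ar d p q).eval n = d * faginT p q m := by
  simp [dTE, NExpr.eval, eval_TE hm]

/-- Value of `NNdTE`. [folklore] -/
theorem eval_NNdTE (hm : (NExpr.codeLenE ar).eval n = m) :
    (NNdTE ar d p q).eval n = NN m (p.eval m) + d * faginT p q m := by
  simp [NNdTE, NExpr.eval, eval_NNE hm, eval_dTE hm]

/-- Value of `S1E`. [folklore] -/
theorem eval_S1E (hm : (NExpr.codeLenE ar).eval n = m) :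
    (S1E ar d p q).eval n = NN m (p.eval m) + d * faginT p q m + 3 * d := by
  simp [S1E, NExpr.eval, eval_NNdTE hm]

/-- Value of `boundE`. [folklore] -/
theorem eval_boundE (hm : (NExpr.codeLenE ar).eval n = m) :
    (boundE ar d p q).eval n = NN m (p.eval m) + d * faginT p q m + 3 * d + faginT p q m + 8 := by
  simp [boundE, NExpr.eval, eval_S1E hm, eval_TE hm]

/-- **What the master bound buys.** [folklore] -/
theorem bounds_of_boundE {K : ℕ} (hb : (boundE ar d p q).Bdd n K) (hm : (NExpr.codeLenE ar).eval n = m) :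
    (NExpr.codeLenE ar).Bdd n K ∧ (PE ar p).Bdd n K ∧ (twoME ar).Bdd n K ∧ (NNE ar p).Bdd n K ∧
      (TE ar p q).Bdd n K ∧ (dTE ar d p q).Bdd n K ∧ (NNdTE ar d p q).Bdd n K ∧
      (S1E ar d p q).Bdd n K ∧ NExpr.size.Bdd n K ∧ n < n ^ K ∧
      NN m (p.eval m) + d * faginT p q m + 3 * d + faginT p q m + 8 < n ^ K := by
  have hval := NExpr.eval_lt_of_bdd hb
  rw [eval_boundE hm] at hval
  obtain ⟨⟨hS1, hT, -⟩, -, -⟩ := hb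
  obtain ⟨hNNdT, -, -⟩ := id hS1
  obtain ⟨hNN, hdT, -⟩ := id hNNdT
  obtain ⟨⟨h2m, -, -⟩, hP, -⟩ := id hNN
  obtain ⟨-, hmE, -⟩ := id h2m
  obtain ⟨⟨⟨hsz, -, -⟩, -, -⟩, -, -⟩ := id hmE
  exact ⟨hmE, hP, h2m, hNN, hT, hdT, hNNdT, hS1, hsz, (Nat.lt_size_self n).trans hsz, hval⟩

variable (ar d p q)

/-- **Choice of the tuple width `K`**: at least `1`, at least every input arity, and large enough
that the master bound is a bounded numeral on every structure with `≥ 2` elements.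
[Libkin 2004, p. 170 ("a machine running in time `n^k`")] [folklore] -/
theorem exists_width : ∃ K : ℕ, 1 ≤ K ∧ (∀ s : Fin ar.length, ar.get s ≤ K) ∧
    ∀ n : ℕ, 2 ≤ n → (boundE ar d p q).Bdd n K := by
  obtain ⟨D, hD⟩ := (boundE ar d p q).exists_forall_bdd
  refine ⟨D + ar.sum + 1, by omega, fun s => ?_, fun n hn => hD n hn _ (by omega)⟩
  have : ar.get s ≤ ar.sum := List.le_sum_of_mem (List.get_mem ar s)
  omega

end Params

end Literature.ModelTheory.FiniteModelTheory
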